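import Mathlib
import HarnessLib
import Summits.Ventures.LatticeQCDFlow.Exactness.IMHKernel

/-!
# Fitting the flow on the OTHER replicas is exact: a block update whose kernel depends arbitrarily on the untouched coordinates and
# leaves `π` invariant in its own coordinate leaves `π ⊗ ν` invariant — for EVERY law `ν` of the other coordinates

HONEST FRAMING: exact (Metropolis-corrected) sampling algorithms for lattice gauge theory;
figures of merit are autocorrelation/cost numbers at stated couplings and volumes; no
continuum-physics claim.

Venture `LatticeQCDFlow` (cell pub-lqcd), topic `Exactness`; FANOUT row 30 (lean-1, GEN-42).  NEW WORK of the cell on GENERAL measurable state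
spaces, over Mathlib (`Measure.prod`, `lintegral_prod_symm`, `Measure.prod_apply_symm`, `Kernel.Invariant.comp`) and the tree's `IMHKernel`.
Printed counterparts, named only (nothing cited as a fact): the complementary-ensemble moves of Goodman–Weare 2010, population ∕ interacting
MCMC (the "leave-one-out" adaptation that stays exactly Markov on the product space), and the practice of (re)training the flow on samples.
Training the flow on the chain's OWN past breaks the Markov property and needs diminishing-adaptation arguments (not exact at finite time);
training it on the OTHER replicas does not.  DEF-FREE: every kernel is "any Markov kernel satisfying the displayed equation".

## Results (no `sorry`, no new definitions)
* §1 THE TWO-BLOCK LEMMA.  `X`, `Y` measurable spaces, `π` on `X` and `ν` on `Y` s-finite; `K : Kernel (X × Y) X` Markov with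
  `∫ K((x, y), A) π(dx) = π(A)` for every `y` ("fibrewise `π`-invariant"); `L` any kernel on `X × Y` with `L(x, y) = K(x, y) ⊗ δ_y` (update the
  first block, keep the second).  `blockUpdate_fst_apply` (`L((x, y), S) = K((x, y), S^y)`), **`blockUpdate_fst_invariant`** — `L` LEAVES
  `π ⊗ ν` INVARIANT FOR EVERY `ν`; mirror statements `blockUpdate_snd_apply`, **`blockUpdate_snd_invariant`** for `M(x, y) = δ_x ⊗ K'(x, y)`;
  **`blockUpdate_alternate_invariant`** — the systematic scan `M ∘ₖ L` (update replica 1 given 2, then replica 2 given the NEW 1) leaves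
  `π ⊗ π'` invariant; `fibre_invariant_of_invariant` (the hypothesis from `Kernel.Invariant` of each fibre kernel).
* §2 THE FLOW SAMPLER FITTED ON THE OTHER REPLICA.  `q_y` (the flow fitted to ∕ conditioned on the other replica's state `y` — any measurable
  family of probability laws) with weights `w_y = dπ/dq_y > 0`, i.e. `w_y·q_y = π` for every `y`; `K((x, y), ·) = indepMH q_y w_y (x, ·)`:
  `crossReplica_fibre_invariant` (each fibre is an exact independence sampler for `π`, `IMHKernel`), **`crossReplica_invariant`** — proposing
  replica 1's update from a flow fitted on replica 2 and accepting with `min(1, w_y(x')/w_y(x))` leaves `π ⊗ ν` invariant WHATEVER the law `ν`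
  of replica 2 (replica 2 may still be burning in: replica 1 stays exact), **`crossReplica_alternate_invariant`** — alternating the two roles
  leaves `π ⊗ π` invariant: the pair of mutually-trained exact flow samplers is exact.
* §3 `R = n + 1` REPLICAS.  `replicaUpdate_apply`, **`replicaUpdate_invariant`** — a replica-`i` kernel `K(z)` fitted on the other `n`
  coordinates (`∫ K(insertNth i x y, A) π(dx) = π(A)` for every `y`) composed with `update z i` leaves "replica `i` ∼ `π`, others ∼ `ν`"
  invariant for EVERY `ν` (transport of §1 along `MeasurableEquiv.piFinSuccAbove`), `replicaUpdate_invariant_pi` (`π^{⊗(n+1)}` invariant),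
  **`crossReplica_invariant_pi`** — the flow-sampler instance: replica `i` proposes from the flow fitted on the other replicas' current
  configurations; exact for `π^{⊗(n+1)}`, and replica `i` stays exact whatever the others' law.
Reading (gauge files): an ensemble of exact gauge-field samplers may refit ∕ condition each member's flow on the current configurations of the
OTHER members at every update without any correction beyond the usual accept/reject step; conditioning on a member's own history is what
exactness forbids.  NOT CLAIMED: rates; anything about self-adaptation; measurability of a concrete training map (the family `y ↦ q_y` is an
input).
-/

noncomputable section

namespace Summit.Ventures.LatticeQCDFlow.Exactness

open MeasureTheory ProbabilityTheory
open scoped ENNReal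

variable {X Y : Type*} [MeasurableSpace X] [MeasurableSpace Y]

/-! ## §1 The two-block lemma -/

/-- From `Kernel.Invariant` of a fibre kernel to the set-wise identity used below. [ours, bookkeeping] -/
theorem fibre_invariant_of_invariant (K : Kernel (X × Y) X) (π : Measure X) (y : Y)
    (h : Kernel.Invariant (K.comap (fun x => (x, y)) measurable_prodMk_right) π) {A : Set X} (hA : MeasurableSet A) :
    ∫⁻ x, K (x, y) A ∂π = π A := by
  have := congrArg (fun μ : Measure X => μ A) h.def
  rw [Measure.bind_apply hA (Kernel.aemeasurable _)] at this
  simpa only [Kernel.comap_apply] using this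

/-- The first-block update kernel, set-wise: `L((x, y), S) = K((x, y), {x' | (x', y) ∈ S})`. [ours, bookkeeping] -/
theorem blockUpdate_fst_apply (K : Kernel (X × Y) X) [IsMarkovKernel K] (L : Kernel (X × Y) (X × Y))
    (hL : ∀ z, L z = (K z).prod (Measure.dirac z.2)) (z : X × Y) {S : Set (X × Y)} (hS : MeasurableSet S) :
    L z S = K z ((fun x' => (x', z.2)) ⁻¹' S) := by
  rw [hL z, Measure.prod_dirac, Measure.map_apply measurable_prodMk_right hS]

/-- **THE TWO-BLOCK LEMMA (first block)**: if every fibre `K(·, y)` leaves `π` invariant, the block update `L(x, y) = K(x, y) ⊗ δ_y` leaves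
`π ⊗ ν` invariant — for EVERY s-finite `ν`. [ours] -/
theorem blockUpdate_fst_invariant (K : Kernel (X × Y) X) [IsMarkovKernel K] (π : Measure X) [SFinite π] (ν : Measure Y) [SFinite ν]
    (hK : ∀ y, ∀ ⦃A : Set X⦄, MeasurableSet A → ∫⁻ x, K (x, y) A ∂π = π A)
    (L : Kernel (X × Y) (X × Y)) (hL : ∀ z, L z = (K z).prod (Measure.dirac z.2)) :
    Kernel.Invariant L (π.prod ν) := by
  change (π.prod ν).bind L = π.prod ν
  ext S hS
  rw [Measure.bind_apply hS (Kernel.aemeasurable _)]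
  have hmeas : Measurable fun z : X × Y => L z S := Kernel.measurable_coe L hS
  rw [lintegral_prod_symm _ hmeas.aemeasurable]
  simp_rw [blockUpdate_fst_apply K L hL _ hS]
  rw [Measure.prod_apply_symm hS]
  refine lintegral_congr fun y => ?_
  exact hK y (measurable_prodMk_right hS)

/-- The second-block update kernel, set-wise: `M((x, y), S) = K'((x, y), {y' | (x, y') ∈ S})`. [ours, bookkeeping] -/
theorem blockUpdate_snd_apply (K' : Kernel (X × Y) Y) [IsMarkovKernel K'] (M : Kernel (X × Y) (X × Y))
    (hM : ∀ z, M z = (Measure.dirac z.1).prod (K' z)) (z : X × Y) {S : Set (X × Y)} (hS : MeasurableSet S) :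
    M z S = K' z ((fun y' => (z.1, y')) ⁻¹' S) := by
  rw [hM z, Measure.dirac_prod, Measure.map_apply measurable_prodMk_left hS]

/-- **THE TWO-BLOCK LEMMA (second block)**: if every fibre `K'(x, ·)` leaves `π'` invariant, the block update `M(x, y) = δ_x ⊗ K'(x, y)` leaves
`μ ⊗ π'` invariant — for EVERY s-finite `μ`. [ours] -/
theorem blockUpdate_snd_invariant (K' : Kernel (X × Y) Y) [IsMarkovKernel K'] (μ : Measure X) [SFinite μ] (π' : Measure Y) [SFinite π']
    (hK' : ∀ x, ∀ ⦃B : Set Y⦄, MeasurableSet B → ∫⁻ y, K' (x, y) B ∂π' = π' B)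
    (M : Kernel (X × Y) (X × Y)) (hM : ∀ z, M z = (Measure.dirac z.1).prod (K' z)) :
    Kernel.Invariant M (μ.prod π') := by
  change (μ.prod π').bind M = μ.prod π'
  ext S hS
  rw [Measure.bind_apply hS (Kernel.aemeasurable _)]
  have hmeas : Measurable fun z : X × Y => M z S := Kernel.measurable_coe M hS
  rw [lintegral_prod _ hmeas.aemeasurable]
  simp_rw [blockUpdate_snd_apply K' M hM _ hS]
  rw [Measure.prod_apply hS]
  refine lintegral_congr fun x => ?_
  exact hK' x (measurable_prodMk_left hS)

/-- **THE SYSTEMATIC SCAN OF THE TWO BLOCKS IS EXACT**: update block 1 given block 2 (fibrewise `π`-invariant), then block 2 given the new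
block 1 (fibrewise `π'`-invariant): the composite `M ∘ₖ L` leaves `π ⊗ π'` invariant. [ours] -/
theorem blockUpdate_alternate_invariant (K : Kernel (X × Y) X) [IsMarkovKernel K] (K' : Kernel (X × Y) Y) [IsMarkovKernel K']
    (π : Measure X) [SFinite π] (π' : Measure Y) [SFinite π']
    (hK : ∀ y, ∀ ⦃A : Set X⦄, MeasurableSet A → ∫⁻ x, K (x, y) A ∂π = π A)
    (hK' : ∀ x, ∀ ⦃B : Set Y⦄, MeasurableSet B → ∫⁻ y, K' (x, y) B ∂π' = π' B)
    (L M : Kernel (X × Y) (X × Y)) (hL : ∀ z, L z = (K z).prod (Measure.dirac z.2))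
    (hM : ∀ z, M z = (Measure.dirac z.1).prod (K' z)) :
    Kernel.Invariant (M ∘ₖ L) (π.prod π') :=
  (blockUpdate_snd_invariant K' π π' hK' M hM).comp (blockUpdate_fst_invariant K π π' hK L hL)

/-! ## §2 The flow sampler whose flow is fitted on the other replica -/

variable {Ω : Type*} [MeasurableSpace Ω]

omit [MeasurableSpace Y] in
/-- Each fibre of the cross-replica flow sampler is an exact independence sampler for `π`: with `w_y·q_y = π`,
`∫ indepMH q_y w_y (x, A) π(dx) = π(A)`. [ours — `IMHKernel.indepMH_invariant`] -/
theorem crossReplica_fibre_invariant (qfam : Y → Measure Ω) [∀ y, IsProbabilityMeasure (qfam y)] (wfam : Y → Ω → ℝ)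
    (hw : ∀ y, Measurable (wfam y)) (hw0 : ∀ y x, 0 < wfam y x) (π : Measure Ω)
    (hπ : ∀ y, (qfam y).withDensity (fun x => ENNReal.ofReal (wfam y x)) = π) (y : Y) {A : Set Ω} (hA : MeasurableSet A) :
    ∫⁻ x, indepMH (qfam y) (wfam y) x A ∂π = π A := by
  have hinv : Kernel.Invariant (indepMH (qfam y) (wfam y)) π := by
    have := indepMH_invariant (q := qfam y) (hw y) (hw0 y)
    rwa [hπ y] at this
  have := congrArg (fun μ : Measure Ω => μ A) hinv.def
  rwa [Measure.bind_apply hA (Kernel.aemeasurable _)] at this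

/-- **THE CROSS-REPLICA FLOW SAMPLER IS EXACT, WHATEVER THE OTHER REPLICA'S LAW**: if replica 1 at `x` is updated by proposing from the
flow `q_y` fitted on replica 2's state `y` and accepting with `min(1, w_y(x')/w_y(x))`, `w_y = dπ/dq_y`, the pair kernel
`L(x, y) = indepMH q_y w_y (x, ·) ⊗ δ_y` leaves `π ⊗ ν` invariant for EVERY s-finite `ν`. [ours] -/
theorem crossReplica_invariant (qfam : Y → Measure Ω) [∀ y, IsProbabilityMeasure (qfam y)] (wfam : Y → Ω → ℝ)
    (hw : ∀ y, Measurable (wfam y)) (hw0 : ∀ y x, 0 < wfam y x) (π : Measure Ω) [SFinite π]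
    (hπ : ∀ y, (qfam y).withDensity (fun x => ENNReal.ofReal (wfam y x)) = π) (ν : Measure Y) [SFinite ν]
    (K : Kernel (Ω × Y) Ω) [IsMarkovKernel K] (hK : ∀ x y, K (x, y) = indepMH (qfam y) (wfam y) x)
    (L : Kernel (Ω × Y) (Ω × Y)) (hL : ∀ z, L z = (K z).prod (Measure.dirac z.2)) :
    Kernel.Invariant L (π.prod ν) := by
  refine blockUpdate_fst_invariant K π ν (fun y A hA => ?_) L hL
  simp_rw [hK]
  exact crossReplica_fibre_invariant qfam wfam hw hw0 π hπ y hA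

/-- **MUTUALLY TRAINED REPLICAS ARE EXACT**: two replicas with target `π`, each updated in turn by an independence sampler whose flow is fitted on
the OTHER replica's current state (`q_y` for replica 1 given replica 2 at `y`, `q'_x` for replica 2 given replica 1 at `x`, weights the
corresponding `dπ/dq`), leave `π ⊗ π` invariant. [ours] -/
theorem crossReplica_alternate_invariant (qfam qfam' : Ω → Measure Ω) [∀ y, IsProbabilityMeasure (qfam y)]
    [∀ x, IsProbabilityMeasure (qfam' x)] (wfam wfam' : Ω → Ω → ℝ)
    (hw : ∀ y, Measurable (wfam y)) (hw0 : ∀ y x, 0 < wfam y x) (hw' : ∀ x, Measurable (wfam' x)) (hw0' : ∀ x y, 0 < wfam' x y)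
    (π : Measure Ω) [SFinite π]
    (hπ : ∀ y, (qfam y).withDensity (fun x => ENNReal.ofReal (wfam y x)) = π)
    (hπ' : ∀ x, (qfam' x).withDensity (fun y => ENNReal.ofReal (wfam' x y)) = π)
    (K K' : Kernel (Ω × Ω) Ω) [IsMarkovKernel K] [IsMarkovKernel K'] (hK : ∀ x y, K (x, y) = indepMH (qfam y) (wfam y) x) (hK' : ∀ x y, K' (x, y) = indepMH (qfam' x) (wfam' x) y)
    (L M : Kernel (Ω × Ω) (Ω × Ω)) (hL : ∀ z, L z = (K z).prod (Measure.dirac z.2)) (hM : ∀ z, M z = (Measure.dirac z.1).prod (K' z)) :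
    Kernel.Invariant (M ∘ₖ L) (π.prod π) := by
  refine blockUpdate_alternate_invariant K K' π π (fun y A hA => ?_) (fun x B hB => ?_) L M hL hM
  · simp_rw [hK]
    exact crossReplica_fibre_invariant qfam wfam hw hw0 π hπ y hA
  · simp_rw [hK']
    exact crossReplica_fibre_invariant qfam' wfam' hw' hw0' π hπ' x hB

/-! ## §3 `R = n + 1` replicas: updating replica `i` with a kernel fitted on the other `n` -/

variable {n : ℕ}

/-- The replica-`i` update kernel, set-wise: `L(z, S) = K(z, {x | update z i x ∈ S})`. [ours, bookkeeping] -/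
theorem replicaUpdate_apply (K : Kernel (Fin (n + 1) → Ω) Ω) [IsMarkovKernel K] (i : Fin (n + 1)) (L : Kernel (Fin (n + 1) → Ω) (Fin (n + 1) → Ω))
    (hL : ∀ z, L z = (K z).map (Function.update z i)) (z : Fin (n + 1) → Ω) {S : Set (Fin (n + 1) → Ω)} (hS : MeasurableSet S) :
    L z S = K z ((Function.update z i) ⁻¹' S) := by
  rw [hL z, Measure.map_apply (measurable_update z) hS]

/-- **THE `R`-REPLICA LEMMA**: if, for every configuration `y` of the other replicas, the replica-`i` kernel leaves `π` invariant
(`∫ K(insertNth i x y, A) π(dx) = π(A)`), then the replica-`i` update `L(z) = K(z) ∘ (update z i)⁻¹` leaves invariant the joint law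
"replica `i` ∼ `π`, the others ∼ `ν`" for EVERY s-finite `ν` on the other replicas. [ours] -/
theorem replicaUpdate_invariant (K : Kernel (Fin (n + 1) → Ω) Ω) [IsMarkovKernel K] (i : Fin (n + 1)) (π : Measure Ω) [SFinite π]
    (ν : Measure (Fin n → Ω)) [SFinite ν]
    (hK : ∀ y : Fin n → Ω, ∀ ⦃A : Set Ω⦄, MeasurableSet A → ∫⁻ x, K (i.insertNth x y) A ∂π = π A)
    (L : Kernel (Fin (n + 1) → Ω) (Fin (n + 1) → Ω)) (hL : ∀ z, L z = (K z).map (Function.update z i)) :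
    Kernel.Invariant L ((π.prod ν).map (MeasurableEquiv.piFinSuccAbove (fun _ : Fin (n + 1) => Ω) i).symm) := by
  set e := MeasurableEquiv.piFinSuccAbove (fun _ : Fin (n + 1) => Ω) i with he
  have hes : ∀ x y, e.symm (x, y) = i.insertNth x y := fun x y => by
    simp [he, MeasurableEquiv.piFinSuccAbove_symm_apply, Fin.insertNthEquiv]
  change ((π.prod ν).map e.symm).bind L = (π.prod ν).map e.symm
  ext S hS
  have hmeas : Measurable fun z : Fin (n + 1) → Ω => L z S := Kernel.measurable_coe L hS
  rw [Measure.bind_apply hS (Kernel.aemeasurable _), lintegral_map hmeas e.symm.measurable, Measure.map_apply e.symm.measurable hS,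
    lintegral_prod_symm (fun a => L (e.symm a) S) (hmeas.comp e.symm.measurable).aemeasurable,
    Measure.prod_apply_symm (e.symm.measurable hS)]
  refine lintegral_congr fun y => ?_
  have hset : ∀ x, (Function.update (i.insertNth x y) i) ⁻¹' S = (fun x' => (x', y)) ⁻¹' (e.symm ⁻¹' S) := fun x => by
    ext x'
    simp only [Set.mem_preimage, Fin.update_insertNth, hes]
  simp_rw [hes, replicaUpdate_apply K i L hL _ hS, hset]
  exact hK y (measurable_prodMk_right (e.symm.measurable hS))

/-- … in particular the product target `π^{⊗(n+1)}` is invariant (all replicas at equilibrium). [ours] -/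
theorem replicaUpdate_invariant_pi (K : Kernel (Fin (n + 1) → Ω) Ω) [IsMarkovKernel K] (i : Fin (n + 1)) (π : Measure Ω) [SigmaFinite π]
    (hK : ∀ y : Fin n → Ω, ∀ ⦃A : Set Ω⦄, MeasurableSet A → ∫⁻ x, K (i.insertNth x y) A ∂π = π A)
    (L : Kernel (Fin (n + 1) → Ω) (Fin (n + 1) → Ω)) (hL : ∀ z, L z = (K z).map (Function.update z i)) :
    Kernel.Invariant L (Measure.pi fun _ : Fin (n + 1) => π) := by
  have h := replicaUpdate_invariant K i π (Measure.pi fun _ : Fin n => π) hK L hL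
  rwa [((measurePreserving_piFinSuccAbove (fun _ : Fin (n + 1) => π) i).symm _).map_eq] at h

/-- **`R` MUTUALLY TRAINED EXACT FLOW SAMPLERS**: replica `i` at `x`, the others at `y`, is updated by proposing from the flow `q_y` fitted on
the OTHER replicas' current configurations and accepting with `min(1, w_y(x')/w_y(x))`, `w_y·q_y = π`; this leaves "replica `i` ∼ `π`, the
others ∼ `ν`" invariant for every s-finite `ν` — replica `i` stays exact whatever the state of the others — and leaves `π^{⊗(n+1)}` invariant;
so does every composition of such updates over `i` (`Kernel.Invariant.comp`). [ours] -/
theorem crossReplica_invariant_pi (qfam : (Fin n → Ω) → Measure Ω) [∀ y, IsProbabilityMeasure (qfam y)] (wfam : (Fin n → Ω) → Ω → ℝ)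
    (hw : ∀ y, Measurable (wfam y)) (hw0 : ∀ y x, 0 < wfam y x) (π : Measure Ω) [SigmaFinite π]
    (hπ : ∀ y, (qfam y).withDensity (fun x => ENNReal.ofReal (wfam y x)) = π) (i : Fin (n + 1))
    (K : Kernel (Fin (n + 1) → Ω) Ω) [IsMarkovKernel K] (hK : ∀ x y, K (i.insertNth x y) = indepMH (qfam y) (wfam y) x)
    (L : Kernel (Fin (n + 1) → Ω) (Fin (n + 1) → Ω)) (hL : ∀ z, L z = (K z).map (Function.update z i)) :
    Kernel.Invariant L (Measure.pi fun _ : Fin (n + 1) => π) ∧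
      ∀ (ν : Measure (Fin n → Ω)) [SFinite ν],
        Kernel.Invariant L ((π.prod ν).map (MeasurableEquiv.piFinSuccAbove (fun _ : Fin (n + 1) => Ω) i).symm) := by
  have hfib : ∀ y : Fin n → Ω, ∀ ⦃A : Set Ω⦄, MeasurableSet A → ∫⁻ x, K (i.insertNth x y) A ∂π = π A := fun y A hA => by
    simp_rw [hK]
    exact crossReplica_fibre_invariant qfam wfam hw hw0 π hπ y hA
  exact ⟨replicaUpdate_invariant_pi K i π hfib L hL, fun ν _ => replicaUpdate_invariant K i π ν hfib L hL⟩

end Summit.Ventures.LatticeQCDFlow.Exactness
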